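import Summits.QuantumFields.BalabanUV.Beta.D1BFx.RestLegEnvelopes
import Summits.QuantumFields.BalabanUV.Beta.D1BFx.ReducedKernel
import Summits.QuantumFields.BalabanUV.Beta.D1BFx.DressedTadpoleTable

/-!
# `BalabanUV.Beta.D1BFx.RestJetEnvelopes` — road «BF-x» for binder row D1, slot (K), DICT-CHAIN-SPEC §2 (II): **THE JETS' LETTER WITH n-EXPLICIT CONSTANTS**
# («VRED-ENV» + «TRED-ENV»): the reduced chain-rule vertex `vertexRed n S μ y = Σ_{κ′} Σ'_u wH^{(n)} κ′ μ (u − n•y) · S κ′ u` of a bond-localised first-jet pack `S` is a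
# `VertexFamily` at blocking `n` with constant `4·(n⁵)⁻¹·C₄·e^{κ′}·Cs·Zl 4 (δS∕2)` and rate `min (κ′∕(4n)) δS ∕ 2`, and the `ℋ ⊗ ℋ`-dressed table
# `tableRed n Wf` is a `VertexFamily₂` with constant `16·((n⁵)⁻¹·C₄·e^{κ′})²·Cf·Zl 4 (δS∕2)²` at the same rate — UNCONDITIONAL (the minimiser kernel's
# n-uniform envelope `FP.CompositeMinimiserDecay.abs_wH_le` through TWO-RATE ∕ ANISOTROPIC superposition lemmas; no `Zl (⋯∕n)` volume factor)

HONEST DEPENDENCY (cell records, verbatim): «continuum YM on T⁴ ⇐ BetaPertH ∧ nine spine estimates (0/9 proved); BetaPertH ⇐ (D1) ∧ (D4) ∧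
CAP+tail; G-an2-4 gates asym, D1 and NE2/3/4.»  HONEST FRAMING (cell contract, verbatim): «discharging `BetaPertH` makes Bałaban's UV stability
UNCONDITIONAL — a real constructive-QFT result; it is NOT the continuum limit and NOT the Clay problem.»  THIS MODULE DISCHARGES NOTHING of the
wall: [folklore] lattice bookkeeping — a two-rate variant of an2's `OneStepResolventKernel.biLoc_wsum` (slowly decaying weights × fast self-localised
stencils: the WEIGHTS' rate survives, the STENCILS' rate pays the volume `Zl`), road FP's `FP.CompositeMinimiserDecay.abs_wH_le` read in fine `ℓ¹` currency
(`RestLegEnvelopes.exp_block_le_exp_fine`), and the typer's `ReducedKernel.vertexRed` BY NAME.  No definition, no `def … : Prop`, nothing cited, no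
printed statement, 0 sorry.  NO (1.22) row; 0 root-level binders of row D1 discharged; (K) NOT closed; NOT D1, NOT `BetaPertH`, NOT continuum, NOT Clay.

ABSOLUTE RULE (cell charter, verbatim): «No internally-minted statement may enter as a cited fact. Every hypothesis is either kernel-proved in
this package or a verbatim quotation of a PUBLISHED theorem with page reference. The manuscript(s) under audit are NOT citable for their own
disputed steps — they are the thing under adjudication; programme-internal (2001/route/tribunal) claims are never citable.»

WHY (`HOME/b2b-balaban-beta-d1-p2/DICT-CHAIN-SPEC.md` v1.2 §2 (II); OWNER W-d1p2-g15-7 (2): the RK-BLK ∕ RK-SAND unit rows need «the leg envelopes of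
RK-LEG-ENV + the jets' bond-localisation»).  The road's N-side jets are reduced vertices `vertexRed n S` (and their `ff` blocks); the typer's
`ReducedKernel.vertexFamily_vertexRed` gives a `VertexFamily` letter with EXPLICIT constants from a `Decay510` letter of `wH` whose rate DOMINATES the
stencil's — but the n-uniform rate of `wH^{(n)}` is `κ′∕(4n)`, far BELOW a bond-local stencil's `O(1)` rate, and equalising rates downward
(`vertexFamily_vertexRed'`) costs the volume factor `Zl 4 (κ′∕(8n)) ~ n⁴`.  The two-rate lemma of §1 keeps the stencil's rate in the volume
factor and the weight's rate in the localisation: constant `(n⁵)⁻¹·(n-free)`, rate `κ′∕(8n)` — the n-power a unit-class count can use.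

CONTENT (`n = m + 1`; `κ′ := kappa163 4 ∕ 4`, `C₄ := MG163 4 · periodConst (kappa163 4) 3` — the constants of `RestLegEnvelopes`).
* §1 [folklore, generic `D F`] `abs_wsumTerm_le_two_rates`, **`biLoc_wsum_two_rates`**: weights `|w u| ≤ C·e^{−δw|u − p|₁}`, stencils
  `BiLoc (K u) u u Ck δK`, `0 < δw ≤ δK` ⊢ `BiLoc (wsum w K) p p (C·Ck·Zl D (δK∕2)) (δw∕2)`.
* §2 [folklore, UNCONDITIONAL] **`abs_wH_fine_le`**: `|wH^{(n)} κ l (u − n•y)| ≤ (n⁵)⁻¹·C₄·e^{κ′}·e^{−(κ′∕(4n))·|u − n•y|₁}`; `decay510_wH_road`.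
* §3 [folklore, UNCONDITIONAL] **`vertexFamily_vertexRed_road`** (`hS : ∀ κ′ u, BiLoc (S κ′ u) u u Cs δS`, `0 < δS`):
  `VertexFamily (vertexRed n S) n (4·((n⁵)⁻¹·C₄·e^{κ′}·Cs·Zl 4 (δS∕2))) (min (κ′∕(4n)) δS ∕ 2)`.
* §4 [folklore] «TRED-ENV»: `tsum_weight_exp_le` (the bracket bound), `abs_wsum_le_aniso` (inner step, ANISOTROPIC output: sharp in the first point, slow
  in the second), `abs_finset_sum_le_aniso`, `abs_wsum_le_of_aniso` (outer step); [UNCONDITIONAL] **`vertexFamily₂_tableRed_road`**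
  (`hWf : ∀ κ′ u λ′ u′, BiLoc (Wf κ′ u λ′ u′) u u′ Cf δS`): `VertexFamily₂ (tableRed n Wf) n (16·(C²·Cf·Zl 4 (δS∕2)²)) (min (κ′∕(4n)) δS ∕ 2)`,
  `C = (n⁵)⁻¹·C₄·e^{κ′}` — NO `Zl (⋯∕n)` volume factor (the typer's `ReducedTableBridge.vertexFamily₂_tableRed` needs the weights' rate to dominate).
NOT HERE (honest): the ff-block projections (`vertexRedF`∕`tableRedF`∕`ffV` — a consumer's `biLoc_blk` line), any (1.22) row.
Unit `b2b-balaban-beta-d1-formalise-leaf-01` (gen 20), D1 formalisation swarm leaf prover 01, road «BF-x»; INTENT 4 «VRED-ENV» (journal).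
-/

noncomputable section

open Finset
open scoped BigOperators
open Literature.MathematicalPhysics.QuantumFieldTheory.Balaban1983to89
open Literature.MathematicalPhysics.QuantumFieldTheory.Balaban1983to89.Beta
open B12Sec2to5 (l1 l1_nonneg Decay510)
open B4ContourShift (supNorm)
open B5Hk163Strip (kappa163 kappa163_pos)
open B5Hk163Decay (MG163)
open B4TorusKernel (periodConst)
open ExpKernelCalculus (Site MKer BiLoc VertexFamily VertexFamily₂ Zl Zl_pos tsum_exp_shift summable_exp_shift l1_sub_triangle)
open KernelSpecInstance (wH)
open OneStepResolventKernel (wsum biLoc_finset_sum bound_mono)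
open Summit.QuantumFields.BalabanUV.Beta.D1BFx.ReducedKernel (StencilR vertexRed)
open Summit.QuantumFields.BalabanUV.Beta.D1BFx.RestLegEnvelopes (exp_block_le_exp_fine)
open Summit.QuantumFields.BalabanUV.Beta.FP.PeriodicTransportSum (quotOf)
open Summit.QuantumFields.BalabanUV.Beta.FP.CompositeMinimiserDecay (abs_wH_le)

namespace Summit.QuantumFields.BalabanUV.Beta.D1BFx.RestJetEnvelopes

/-! ## §1 Slowly decaying weights × fast self-localised stencils (two rates) -/

section TwoRates

variable {D : ℕ} {F : Type*}

/-- [folklore] The term estimate behind `biLoc_wsum_two_rates`: for `δw ≤ δK`,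
`|w u · K u x z a b| ≤ C·Ck·e^{−(δw∕2)(|x − p|₁ + |z − p|₁)}·e^{−(δK∕2)|x − u|₁}` (two triangle inequalities through `u`). -/
theorem abs_wsumTerm_le_two_rates {w : (Fin D → ℤ) → ℝ} {K : (Fin D → ℤ) → MKer D F} {C Ck δw δK : ℝ} {p : Fin D → ℤ}
    (hw : ∀ u, |w u| ≤ C * Real.exp (-δw * l1 (u - p))) (hK : ∀ u, BiLoc (K u) u u Ck δK) (hδw : 0 ≤ δw) (hle : δw ≤ δK)
    (hC : 0 ≤ C) (x z : Fin D → ℤ) (a b : F) (u : Fin D → ℤ) :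
    |w u * K u x z a b| ≤
      C * Ck * Real.exp (-(δw / 2) * (l1 (x - p) + l1 (z - p))) * Real.exp (-(δK / 2) * l1 (x - u)) := by
  rw [abs_mul]
  have h1 := hw u
  have h2 := hK u x z a b
  have hCk : 0 ≤ Ck := (hK u).nonneg a
  calc |w u| * |K u x z a b|
      ≤ (C * Real.exp (-δw * l1 (u - p))) * (Ck * Real.exp (-δK * (l1 (x - u) + l1 (z - u)))) :=
        mul_le_mul h1 h2 (abs_nonneg _) ((abs_nonneg _).trans h1)
    _ = C * Ck * Real.exp (-δw * l1 (u - p) + -δK * (l1 (x - u) + l1 (z - u))) := by rw [Real.exp_add]; ring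
    _ ≤ C * Ck * Real.exp (-(δw / 2) * (l1 (x - p) + l1 (z - p)) + -(δK / 2) * l1 (x - u)) := by
        refine mul_le_mul_of_nonneg_left (Real.exp_le_exp.2 ?_) (mul_nonneg hC hCk)
        have tx : l1 (x - p) ≤ l1 (x - u) + l1 (u - p) := l1_sub_triangle x u p
        have tz : l1 (z - p) ≤ l1 (z - u) + l1 (u - p) := l1_sub_triangle z u p
        have hxu := l1_nonneg (x - u)
        have hzu := l1_nonneg (z - u)
        have hKw : 0 ≤ δK - δw := by linarith
        nlinarith [mul_nonneg hδw (show 0 ≤ l1 (x - u) + l1 (u - p) - l1 (x - p) by linarith),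
          mul_nonneg hδw (show 0 ≤ l1 (z - u) + l1 (u - p) - l1 (z - p) by linarith),
          mul_nonneg hKw hxu, mul_nonneg hKw hzu, mul_nonneg hδw hzu, mul_nonneg (le_trans hδw hle) hzu]
    _ = _ := by rw [Real.exp_add]; ring

/-- [folklore] **SLOWLY DECAYING WEIGHTS × FAST SELF-LOCALISED STENCILS ⇒ BI-LOCALISED AT THE WEIGHTS' RATE, WITH THE STENCILS' VOLUME FACTOR**:
for `0 < δw ≤ δK`, `BiLoc (wsum w K) p p (C·Ck·Zl D (δK∕2)) (δw∕2)` — an2's `OneStepResolventKernel.biLoc_wsum` with the two rates kept apart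
(there `δw = δK`; equalising a slow `δw ~ 1∕n` downward would cost `Zl D (δw∕2) ~ n^D`). -/
theorem biLoc_wsum_two_rates {w : (Fin D → ℤ) → ℝ} {K : (Fin D → ℤ) → MKer D F} {C Ck δw δK : ℝ} {p : Fin D → ℤ}
    (hw : ∀ u, |w u| ≤ C * Real.exp (-δw * l1 (u - p))) (hK : ∀ u, BiLoc (K u) u u Ck δK) (hδw : 0 < δw) (hle : δw ≤ δK)
    (hC : 0 ≤ C) : BiLoc (wsum w K) p p (C * Ck * Zl D (δK / 2)) (δw / 2) := by
  intro x z a b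
  unfold wsum
  have hδK : 0 < δK := lt_of_lt_of_le hδw hle
  have hs := summable_exp_shift (half_pos hδK) x
  have hmaj := hs.mul_left (C * Ck * Real.exp (-(δw / 2) * (l1 (x - p) + l1 (z - p))))
  have hb := tsum_of_norm_bounded hmaj.hasSum
    (fun u => by rw [Real.norm_eq_abs]; exact abs_wsumTerm_le_two_rates hw hK hδw.le hle hC x z a b u)
  rw [Real.norm_eq_abs] at hb
  refine hb.trans (le_of_eq ?_)
  rw [tsum_mul_left, tsum_exp_shift]
  ring

end TwoRates

/-! ## §2 The minimiser kernel's envelope in fine `ℓ¹` currency (UNCONDITIONAL) -/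

section WH

variable (m : ℕ)

/-- [folklore] **«WH-ENV» IN FINE `ℓ¹` CURRENCY** (UNCONDITIONAL, every `n = m + 1`): for every fine `u`, coarse `y` and colours `κ l`,
`|wH^{(n)} κ l (u − n•y)| ≤ (n⁵)⁻¹·C₄·e^{κ′}·e^{−(κ′∕(4n))·|u − n•y|₁}` — road FP's `FP.CompositeMinimiserDecay.abs_wH_le` (block-scale sup-norm decay)
through `RestLegEnvelopes.exp_block_le_exp_fine`. -/
theorem abs_wH_fine_le (κ l : Fin 4) (u y : Fin 4 → ℤ) :
    |wH (d := 3) (N := m + 1) κ l (u - ((m + 1 : ℕ) : ℤ) • y)|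
      ≤ ((((m + 1 : ℕ) : ℝ)) ^ (3 + 2))⁻¹ * (MG163 (3 + 1) * periodConst (kappa163 (3 + 1)) 3) * Real.exp (kappa163 (3 + 1) / (3 + 1))
          * Real.exp (-(kappa163 (3 + 1) / (3 + 1) / (4 * ((m + 1 : ℕ) : ℝ))) * l1 (u - ((m + 1 : ℕ) : ℤ) • y)) := by
  have hκ : 0 ≤ kappa163 (3 + 1) / (3 + 1) := by have := kappa163_pos (3 + 1); positivity
  have h := abs_wH_le (d := 3) (m + 1) (Nat.le_add_left 1 m) κ l u y
  have hC : 0 ≤ ((((m + 1 : ℕ) : ℝ)) ^ (3 + 2))⁻¹ * (MG163 (3 + 1) * periodConst (kappa163 (3 + 1)) 3) :=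
    (mul_nonneg_iff_of_pos_right (Real.exp_pos _)).1 ((abs_nonneg _).trans h)
  refine h.trans ?_
  rw [mul_assoc (_ * _) (Real.exp _)]
  exact mul_le_mul_of_nonneg_left (exp_block_le_exp_fine m hκ u y) hC

/-- [folklore] … at `y = 0`: `Decay510 (wH^{(n)} κ l) ((n⁵)⁻¹·C₄·e^{κ′}) (κ′∕(4n))` — the `hwH` letter of the typer's `ReducedKernel.vertexFamily_vertexRed`
with n-EXPLICIT constants (UNCONDITIONAL). -/
theorem decay510_wH_road (κ l : Fin 4) :
    Decay510 (wH (d := 3) (N := m + 1) κ l)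
      (((((m + 1 : ℕ) : ℝ)) ^ (3 + 2))⁻¹ * (MG163 (3 + 1) * periodConst (kappa163 (3 + 1)) 3) * Real.exp (kappa163 (3 + 1) / (3 + 1)))
      (kappa163 (3 + 1) / (3 + 1) / (4 * ((m + 1 : ℕ) : ℝ))) := by
  intro u
  have h := abs_wH_fine_le m κ l u 0
  simp only [smul_zero, sub_zero] at h
  exact h

end WH

/-! ## §3 «VRED-ENV»: the reduced vertex of a bond-localised pack, n-explicit (UNCONDITIONAL) -/

section VRed

variable (m : ℕ)

/-- [folklore] **«VRED-ENV»** (UNCONDITIONAL, every `n = m + 1`): for a first-jet pack `S` whose stencils are bi-localised at their bond (`BiLoc (S κ′ u) u u Cs δS`,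
`0 < δS`), the reduced chain-rule vertex is a vertex family at blocking `n` with
constant `4·((n⁵)⁻¹·C₄·e^{κ′}·Cs·Zl 4 (δS∕2))` and rate `min (κ′∕(4n)) δS ∕ 2` — the weights `wH^{(n)} κ′ μ (u − n•y)` (§2) superposed by §1 at the
two rates (weights `min (κ′∕(4n)) δS`, stencils `δS`), summed over the four colours (`biLoc_finset_sum`). -/
theorem vertexFamily_vertexRed_road {S : StencilR} {Cs δS : ℝ} (hS : ∀ κ' u, BiLoc (S κ' u) u u Cs δS) (hδS : 0 < δS) :
    VertexFamily (vertexRed (m + 1) S) (m + 1)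
      ((4 : ℕ) * (((((m + 1 : ℕ) : ℝ)) ^ (3 + 2))⁻¹ * (MG163 (3 + 1) * periodConst (kappa163 (3 + 1)) 3) * Real.exp (kappa163 (3 + 1) / (3 + 1))
        * Cs * Zl 4 (δS / 2)))
      (min (kappa163 (3 + 1) / (3 + 1) / (4 * ((m + 1 : ℕ) : ℝ))) δS / 2) := by
  intro μ y
  have hnpos : (0 : ℝ) < ((m + 1 : ℕ) : ℝ) := by exact_mod_cast Nat.succ_pos m
  have hκ : 0 < kappa163 (3 + 1) / (3 + 1) / (4 * ((m + 1 : ℕ) : ℝ)) := by have := kappa163_pos (3 + 1); positivity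
  set δw : ℝ := min (kappa163 (3 + 1) / (3 + 1) / (4 * ((m + 1 : ℕ) : ℝ))) δS with hδw
  have hδw0 : 0 < δw := lt_min hκ hδS
  have hδwle : δw ≤ δS := min_le_right _ _
  set C : ℝ := ((((m + 1 : ℕ) : ℝ)) ^ (3 + 2))⁻¹ * (MG163 (3 + 1) * periodConst (kappa163 (3 + 1)) 3) * Real.exp (kappa163 (3 + 1) / (3 + 1)) with hCdef
  have hC : 0 ≤ C := by
    have h := decay510_wH_road m 0 0 0
    have : (0 : ℝ) ≤ C * Real.exp (-(kappa163 (3 + 1) / (3 + 1) / (4 * ((m + 1 : ℕ) : ℝ))) * l1 (0 : Fin 4 → ℤ)) := (abs_nonneg _).trans h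
    exact (mul_nonneg_iff_of_pos_right (Real.exp_pos _)).1 this
  -- the weights at the slow rate `δw ≤ κ′∕(4n)`
  have hw : ∀ (κ' : Fin 4) (u : Fin 4 → ℤ), |wH (d := 3) (N := m + 1) κ' μ (u - ((m + 1 : ℕ) : ℤ) • y)|
      ≤ C * Real.exp (-δw * l1 (u - ((m + 1 : ℕ) : ℤ) • y)) := by
    intro κ' u
    refine (abs_wH_fine_le m κ' μ u y).trans (mul_le_mul_of_nonneg_left (Real.exp_le_exp.2 ?_) hC)
    have h1 : δw ≤ kappa163 (3 + 1) / (3 + 1) / (4 * ((m + 1 : ℕ) : ℝ)) := min_le_left _ _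
    have h2 := l1_nonneg (u - ((m + 1 : ℕ) : ℤ) • y)
    nlinarith
  have hterm : ∀ κ' : Fin 4, BiLoc (wsum (fun u => wH (d := 3) (N := m + 1) κ' μ (u - ((m + 1 : ℕ) : ℤ) • y)) (S κ'))
      (((m + 1 : ℕ) : ℤ) • y) (((m + 1 : ℕ) : ℤ) • y) (C * Cs * Zl 4 (δS / 2)) (δw / 2) := fun κ' =>
    biLoc_wsum_two_rates (hw κ') (fun u => hS κ' u) hδw0 hδwle hC
  have hsum := biLoc_finset_sum (Finset.univ : Finset (Fin 4)) (fun κ' _ => hterm κ')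
  simp only [Finset.sum_const, Finset.card_univ, Fintype.card_fin, nsmul_eq_mul] at hsum
  exact hsum

end VRed

/-! ## §4 «TRED-ENV»: the `ℋ ⊗ ℋ`-dressed second-order table, n-explicit (UNCONDITIONAL) -/

section Table

variable {D : ℕ} {F : Type*}

/-- [folklore] **THE BRACKET BOUND**: slow weights (`|w u| ≤ C·e^{−δw|u − p|₁}`, `0 < δw ≤ δK`) against a fast exponential:
`Σ'_u |w u|·e^{−δK|x − u|₁} ≤ C·Zl D (δK∕2)·e^{−(δw∕2)|x − p|₁}` (and the series is summable). -/
theorem tsum_weight_exp_le {w : (Fin D → ℤ) → ℝ} {C δw δK : ℝ} {p : Fin D → ℤ}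
    (hw : ∀ u, |w u| ≤ C * Real.exp (-δw * l1 (u - p))) (hδw : 0 < δw) (hle : δw ≤ δK) (hC : 0 ≤ C) (x : Fin D → ℤ) :
    Summable (fun u => |w u| * Real.exp (-δK * l1 (x - u))) ∧
      ∑' u, |w u| * Real.exp (-δK * l1 (x - u)) ≤ C * Zl D (δK / 2) * Real.exp (-(δw / 2) * l1 (x - p)) := by
  have hδK : 0 < δK := lt_of_lt_of_le hδw hle
  -- termwise majorant
  have hterm : ∀ u, |w u| * Real.exp (-δK * l1 (x - u))
      ≤ C * Real.exp (-(δw / 2) * l1 (x - p)) * Real.exp (-(δK / 2) * l1 (x - u)) := by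
    intro u
    have h1 := hw u
    calc |w u| * Real.exp (-δK * l1 (x - u))
        ≤ C * Real.exp (-δw * l1 (u - p)) * Real.exp (-δK * l1 (x - u)) :=
          mul_le_mul_of_nonneg_right h1 (Real.exp_pos _).le
      _ = C * Real.exp (-δw * l1 (u - p) + -δK * l1 (x - u)) := by rw [Real.exp_add]; ring
      _ ≤ C * Real.exp (-(δw / 2) * l1 (x - p) + -(δK / 2) * l1 (x - u)) := by
          refine mul_le_mul_of_nonneg_left (Real.exp_le_exp.2 ?_) hC
          have tx : l1 (x - p) ≤ l1 (x - u) + l1 (u - p) := l1_sub_triangle x u p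
          have hxu := l1_nonneg (x - u)
          have hup := l1_nonneg (u - p)
          nlinarith [mul_nonneg hδw.le hxu, mul_nonneg (show 0 ≤ δK - δw by linarith) hxu, mul_nonneg hδw.le hup]
      _ = _ := by rw [Real.exp_add]; ring
  have hs := (summable_exp_shift (half_pos hδK) x).mul_left (C * Real.exp (-(δw / 2) * l1 (x - p)))
  have hnn : ∀ u, 0 ≤ |w u| * Real.exp (-δK * l1 (x - u)) := fun u => mul_nonneg (abs_nonneg _) (Real.exp_pos _).le
  have hsum : Summable (fun u => |w u| * Real.exp (-δK * l1 (x - u))) := Summable.of_nonneg_of_le hnn hterm hs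
  refine ⟨hsum, (hsum.tsum_le_tsum hterm hs).trans (le_of_eq ?_)⟩
  rw [tsum_mul_left, tsum_exp_shift]
  ring

/-- [folklore] **INNER STEP, ANISOTROPIC OUTPUT**: slow weights `w₂` (rate `δw`, centre `q`) against a fine table `u′ ↦ Wf u′` bi-localised at `(u, u′)`
(rate `δK ≥ δw`): `|wsum w₂ Wf x z a b| ≤ C₂·Cf·Zl D (δK∕2)·e^{−δK|x − u|₁}·e^{−(δw∕2)|z − q|₁}` — SHARP in `x` at `u`, SLOW in `z` at `q`. -/
theorem abs_wsum_le_aniso {w₂ : (Fin D → ℤ) → ℝ} {Wf : (Fin D → ℤ) → MKer D F} {C₂ Cf δw δK : ℝ} {q u : Fin D → ℤ}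
    (hw : ∀ u', |w₂ u'| ≤ C₂ * Real.exp (-δw * l1 (u' - q))) (hWf : ∀ u', BiLoc (Wf u') u u' Cf δK) (hδw : 0 < δw) (hle : δw ≤ δK)
    (hC₂ : 0 ≤ C₂) (x z : Fin D → ℤ) (a b : F) :
    |wsum w₂ Wf x z a b| ≤ C₂ * Cf * Zl D (δK / 2) * Real.exp (-δK * l1 (x - u)) * Real.exp (-(δw / 2) * l1 (z - q)) := by
  unfold wsum
  obtain ⟨hs, hb⟩ := tsum_weight_exp_le hw hδw hle hC₂ z
  have hCf : 0 ≤ Cf := (hWf q).nonneg a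
  have hterm : ∀ u', ‖w₂ u' * Wf u' x z a b‖ ≤ Cf * Real.exp (-δK * l1 (x - u)) * (|w₂ u'| * Real.exp (-δK * l1 (z - u'))) := by
    intro u'
    rw [Real.norm_eq_abs, abs_mul]
    have h2 := hWf u' x z a b
    calc |w₂ u'| * |Wf u' x z a b| ≤ |w₂ u'| * (Cf * Real.exp (-δK * (l1 (x - u) + l1 (z - u')))) :=
          mul_le_mul_of_nonneg_left h2 (abs_nonneg _)
      _ = Cf * Real.exp (-δK * l1 (x - u)) * (|w₂ u'| * Real.exp (-δK * l1 (z - u'))) := by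
          rw [mul_add, Real.exp_add]; ring
  have hmaj := hs.mul_left (Cf * Real.exp (-δK * l1 (x - u)))
  have h := tsum_of_norm_bounded hmaj.hasSum hterm
  rw [Real.norm_eq_abs] at h
  refine h.trans ?_
  rw [tsum_mul_left]
  calc Cf * Real.exp (-δK * l1 (x - u)) * ∑' u', |w₂ u'| * Real.exp (-δK * l1 (z - u'))
      ≤ Cf * Real.exp (-δK * l1 (x - u)) * (C₂ * Zl D (δK / 2) * Real.exp (-(δw / 2) * l1 (z - q))) :=
        mul_le_mul_of_nonneg_left hb (by positivity)
    _ = _ := by ring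

/-- [folklore] Anisotropic bounds add over a finite index (same exponentials, constants summed). -/
theorem abs_finset_sum_le_aniso {ι : Type*} (s : Finset ι) {K : ι → MKer D F} {c : ι → ℝ} {E : ℝ} {x z : Fin D → ℤ} {a b : F}
    (h : ∀ i ∈ s, |K i x z a b| ≤ c i * E) : |(∑ i ∈ s, K i) x z a b| ≤ (∑ i ∈ s, c i) * E := by
  rw [Finset.sum_apply, Finset.sum_apply, Finset.sum_apply, Finset.sum_apply, Finset.sum_mul]
  exact (Finset.abs_sum_le_sum_abs _ _).trans (Finset.sum_le_sum h)

/-- [folklore] **OUTER STEP**: slow weights `w₁` (rate `δw`, centre `p`) against intermediate kernels `K u` that are SHARP in `x` at `u` (rate `δK ≥ δw`)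
and SLOW in `z` at `q` (any factor `E ≥ 0`): `|wsum w₁ K x z a b| ≤ C₁·Ck·Zl D (δK∕2)·e^{−(δw∕2)|x − p|₁}·E`. -/
theorem abs_wsum_le_of_aniso {w₁ : (Fin D → ℤ) → ℝ} {K : (Fin D → ℤ) → MKer D F} {C₁ Ck δw δK E : ℝ} {p : Fin D → ℤ}
    (hw : ∀ u, |w₁ u| ≤ C₁ * Real.exp (-δw * l1 (u - p))) (hδw : 0 < δw) (hle : δw ≤ δK) (hC₁ : 0 ≤ C₁) (hCk : 0 ≤ Ck) (hE : 0 ≤ E)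
    {x z : Fin D → ℤ} {a b : F} (hK : ∀ u, |K u x z a b| ≤ Ck * Real.exp (-δK * l1 (x - u)) * E) :
    |wsum w₁ K x z a b| ≤ C₁ * Ck * Zl D (δK / 2) * Real.exp (-(δw / 2) * l1 (x - p)) * E := by
  unfold wsum
  obtain ⟨hs, hb⟩ := tsum_weight_exp_le hw hδw hle hC₁ x
  have hterm : ∀ u, ‖w₁ u * K u x z a b‖ ≤ Ck * E * (|w₁ u| * Real.exp (-δK * l1 (x - u))) := by
    intro u
    rw [Real.norm_eq_abs, abs_mul]
    calc |w₁ u| * |K u x z a b| ≤ |w₁ u| * (Ck * Real.exp (-δK * l1 (x - u)) * E) := mul_le_mul_of_nonneg_left (hK u) (abs_nonneg _)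
      _ = Ck * E * (|w₁ u| * Real.exp (-δK * l1 (x - u))) := by ring
  have hmaj := hs.mul_left (Ck * E)
  have h := tsum_of_norm_bounded hmaj.hasSum hterm
  rw [Real.norm_eq_abs] at h
  refine h.trans ?_
  rw [tsum_mul_left]
  calc Ck * E * ∑' u, |w₁ u| * Real.exp (-δK * l1 (x - u))
      ≤ Ck * E * (C₁ * Zl D (δK / 2) * Real.exp (-(δw / 2) * l1 (x - p))) := mul_le_mul_of_nonneg_left hb (mul_nonneg hCk hE)
    _ = _ := by ring

end Table

section TRed

open Summit.QuantumFields.BalabanUV.Beta.D1BFx.DressedTadpoleTable (Table₂R tableRed)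

variable (m : ℕ)

/-- [folklore] **«TRED-ENV»** (UNCONDITIONAL, every `n = m + 1`): for fine second-order tables bi-localised at their two bonds
(`BiLoc (Wf κ′ u λ′ u′) u u′ Cf δS`, `0 < δS`), the `ℋ ⊗ ℋ`-dressed table `tableRed n Wf` is a second-order vertex family at blocking `n` with
constant `16·(C²·Cf·Zl 4 (δS∕2)²)`, `C = (n⁵)⁻¹·C₄·e^{κ′}`, and rate `min (κ′∕(4n)) δS ∕ 2` — the double superposition done ANISOTROPICALLY (inner step sharp
in the first point, slow in the second; outer step slow in the first), so the stencils' rate pays both volume factors and NO `Zl (⋯∕n)` appears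
(the typer's `vertexFamily₂_tableRed` needs the weights' rate to dominate and would cost `n⁸` here). -/
theorem vertexFamily₂_tableRed_road {Wf : Table₂R} {Cf δS : ℝ} (hWf : ∀ κ' u l' u', BiLoc (Wf κ' u l' u') u u' Cf δS) (hδS : 0 < δS) :
    VertexFamily₂ (tableRed (m + 1) Wf) (m + 1)
      ((4 : ℕ) * ((4 : ℕ) * ((((((m + 1 : ℕ) : ℝ)) ^ (3 + 2))⁻¹ * (MG163 (3 + 1) * periodConst (kappa163 (3 + 1)) 3) * Real.exp (kappa163 (3 + 1) / (3 + 1)))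
        * (((((m + 1 : ℕ) : ℝ)) ^ (3 + 2))⁻¹ * (MG163 (3 + 1) * periodConst (kappa163 (3 + 1)) 3) * Real.exp (kappa163 (3 + 1) / (3 + 1)))
        * Cf * Zl 4 (δS / 2) * Zl 4 (δS / 2))))
      (min (kappa163 (3 + 1) / (3 + 1) / (4 * ((m + 1 : ℕ) : ℝ))) δS / 2) := by
  intro μ y ν y'
  have hnpos : (0 : ℝ) < ((m + 1 : ℕ) : ℝ) := by exact_mod_cast Nat.succ_pos m
  have hκ : 0 < kappa163 (3 + 1) / (3 + 1) / (4 * ((m + 1 : ℕ) : ℝ)) := by have := kappa163_pos (3 + 1); positivity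
  set δw : ℝ := min (kappa163 (3 + 1) / (3 + 1) / (4 * ((m + 1 : ℕ) : ℝ))) δS with hδw
  have hδw0 : 0 < δw := lt_min hκ hδS
  have hδwle : δw ≤ δS := min_le_right _ _
  set C : ℝ := ((((m + 1 : ℕ) : ℝ)) ^ (3 + 2))⁻¹ * (MG163 (3 + 1) * periodConst (kappa163 (3 + 1)) 3) * Real.exp (kappa163 (3 + 1) / (3 + 1)) with hCdef
  have hC : 0 ≤ C := by
    have h := decay510_wH_road m 0 0 0
    have : (0 : ℝ) ≤ C * Real.exp (-(kappa163 (3 + 1) / (3 + 1) / (4 * ((m + 1 : ℕ) : ℝ))) * l1 (0 : Fin 4 → ℤ)) := (abs_nonneg _).trans h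
    exact (mul_nonneg_iff_of_pos_right (Real.exp_pos _)).1 this
  have hCf : 0 ≤ Cf := (hWf 0 0 0 0).nonneg 0
  have hZ : 0 ≤ Zl 4 (δS / 2) := (Zl_pos (D := 4) (half_pos hδS)).le
  -- the weights at the slow rate, both bonds
  have hw : ∀ (κ' l : Fin 4) (q u : Fin 4 → ℤ), |wH (d := 3) (N := m + 1) κ' l (u - ((m + 1 : ℕ) : ℤ) • q)|
      ≤ C * Real.exp (-δw * l1 (u - ((m + 1 : ℕ) : ℤ) • q)) := by
    intro κ' l q u
    refine (abs_wH_fine_le m κ' l u q).trans (mul_le_mul_of_nonneg_left (Real.exp_le_exp.2 ?_) hC)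
    have h1 : δw ≤ kappa163 (3 + 1) / (3 + 1) / (4 * ((m + 1 : ℕ) : ℝ)) := min_le_left _ _
    have h2 := l1_nonneg (u - ((m + 1 : ℕ) : ℤ) • q)
    nlinarith
  intro x z a b
  -- inner step, per `(κ′, u, λ′)`: sharp in `x` at `u`, slow in `z` at `n•y′`
  have hinner : ∀ (κ' : Fin 4) (u : Fin 4 → ℤ) (l' : Fin 4),
      |wsum (fun u' => wH (d := 3) (N := m + 1) l' ν (u' - ((m + 1 : ℕ) : ℤ) • y')) (Wf κ' u l') x z a b|
        ≤ C * Cf * Zl 4 (δS / 2) * Real.exp (-δS * l1 (x - u)) * Real.exp (-(δw / 2) * l1 (z - ((m + 1 : ℕ) : ℤ) • y')) :=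
    fun κ' u l' => abs_wsum_le_aniso (hw l' ν y') (fun u' => hWf κ' u l' u') hδw0 hδwle hC x z a b
  -- summed over `λ′`
  have hmid : ∀ (κ' : Fin 4) (u : Fin 4 → ℤ),
      |(fun x z a b => ∑ l' : Fin 4, wsum (fun u' => wH (d := 3) (N := m + 1) l' ν (u' - ((m + 1 : ℕ) : ℤ) • y')) (Wf κ' u l') x z a b)
          x z a b|
        ≤ (4 : ℕ) * (C * Cf * Zl 4 (δS / 2)) * Real.exp (-δS * l1 (x - u)) * Real.exp (-(δw / 2) * l1 (z - ((m + 1 : ℕ) : ℤ) • y')) := by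
    intro κ' u
    have h := Finset.abs_sum_le_sum_abs (fun l' : Fin 4 =>
      wsum (fun u' => wH (d := 3) (N := m + 1) l' ν (u' - ((m + 1 : ℕ) : ℤ) • y')) (Wf κ' u l') x z a b) Finset.univ
    refine h.trans ?_
    calc ∑ l' : Fin 4, |wsum (fun u' => wH (d := 3) (N := m + 1) l' ν (u' - ((m + 1 : ℕ) : ℤ) • y')) (Wf κ' u l') x z a b|
        ≤ ∑ _l' : Fin 4, C * Cf * Zl 4 (δS / 2) * Real.exp (-δS * l1 (x - u)) * Real.exp (-(δw / 2) * l1 (z - ((m + 1 : ℕ) : ℤ) • y')) :=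
          Finset.sum_le_sum fun l' _ => hinner κ' u l'
      _ = _ := by rw [Finset.sum_const, Finset.card_univ, Fintype.card_fin, nsmul_eq_mul]; ring
  -- outer step, per `κ′`
  have houter : ∀ κ' : Fin 4,
      |wsum (fun u => wH (d := 3) (N := m + 1) κ' μ (u - ((m + 1 : ℕ) : ℤ) • y))
          (fun u => fun x z a b => ∑ l' : Fin 4, wsum (fun u' => wH (d := 3) (N := m + 1) l' ν (u' - ((m + 1 : ℕ) : ℤ) • y')) (Wf κ' u l') x z a b)
          x z a b|
        ≤ C * ((4 : ℕ) * (C * Cf * Zl 4 (δS / 2))) * Zl 4 (δS / 2) * Real.exp (-(δw / 2) * l1 (x - ((m + 1 : ℕ) : ℤ) • y))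
            * Real.exp (-(δw / 2) * l1 (z - ((m + 1 : ℕ) : ℤ) • y')) :=
    fun κ' => abs_wsum_le_of_aniso (hw κ' μ y) hδw0 hδwle hC (by positivity) (Real.exp_pos _).le (hmid κ')
  -- summed over `κ′`, and the `BiLoc` shape
  have h := Finset.abs_sum_le_sum_abs (fun κ' : Fin 4 =>
    wsum (fun u => wH (d := 3) (N := m + 1) κ' μ (u - ((m + 1 : ℕ) : ℤ) • y))
      (fun u => fun x z a b => ∑ l' : Fin 4, wsum (fun u' => wH (d := 3) (N := m + 1) l' ν (u' - ((m + 1 : ℕ) : ℤ) • y')) (Wf κ' u l') x z a b)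
      x z a b) Finset.univ
  refine h.trans ?_
  calc ∑ κ' : Fin 4, |wsum (fun u => wH (d := 3) (N := m + 1) κ' μ (u - ((m + 1 : ℕ) : ℤ) • y))
          (fun u => fun x z a b => ∑ l' : Fin 4, wsum (fun u' => wH (d := 3) (N := m + 1) l' ν (u' - ((m + 1 : ℕ) : ℤ) • y')) (Wf κ' u l') x z a b)
          x z a b|
      ≤ ∑ _κ' : Fin 4, C * ((4 : ℕ) * (C * Cf * Zl 4 (δS / 2))) * Zl 4 (δS / 2) * Real.exp (-(δw / 2) * l1 (x - ((m + 1 : ℕ) : ℤ) • y))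
            * Real.exp (-(δw / 2) * l1 (z - ((m + 1 : ℕ) : ℤ) • y')) := Finset.sum_le_sum fun κ' _ => houter κ'
    _ = (4 : ℕ) * ((4 : ℕ) * (C * C * Cf * Zl 4 (δS / 2) * Zl 4 (δS / 2)))
          * Real.exp (-(δw / 2) * (l1 (x - ((m + 1 : ℕ) : ℤ) • y) + l1 (z - ((m + 1 : ℕ) : ℤ) • y'))) := by
        rw [Finset.sum_const, Finset.card_univ, Fintype.card_fin, nsmul_eq_mul, mul_add, Real.exp_add]; ring

end TRed

end Summit.QuantumFields.BalabanUV.Beta.D1BFx.RestJetEnvelopes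

end
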